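import Summits.AnomalousDissipation.AnomalousDissipation.Theorems.DriftStatesAreLerayHopf.Negative.DriftPlaneFlow

/-!
# Every Leray–Hopf solution from the drift plane has the steady means; the Kolmogorov plane
# carries no zeroth-law witness

Negative-lane file (small-model facts; no Theses statement is asserted). Forced weak–strong
uniqueness (`Torus.IsGlobalLerayHopf.ae_eq_of_isClassicalNSSolutionOn_univ_forced`) against the
explicit plane flow of `DriftPlaneFlow`: for `ν > 0`, `k ≠ 0`, `⟪k,v⟫ = 0`, EVERY global Leray–Hopf
solution with the steady single-mode force and ANY datum `W + a₀ sin v + b₀ cos v` on the invariant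
plane has mean energy `‖W‖² + ½‖v‖²(a⋆² + b⋆²)` and mean dissipation `νλ·½‖v‖²(a⋆² + b⋆²)` — the
values of the steady drift state, whatever the initial amplitudes (`means_eq_of_isGlobalLerayHopf_driftPlane`).
At the Kolmogorov force `sin(4πx₁)e₀` (`λ = 16π²`, `σ = ⟪(0,2,0),W⟫ = 2W₁`, `G = 64π²ν² + σ²`):
`⟨‖u‖²⟩ = ‖W‖² + 1/(8π²G)`, `⟨ν‖∇u‖²⟩ = 2ν/G` (`means_eq_of_isGlobalLerayHopf_kolmogorovPlane`);
consequently NO sequence of data on the Kolmogorov plane (drifts `Wⱼ`, amplitudes `a₀ⱼ, b₀ⱼ`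
arbitrary, `νⱼ → 0`) yields the zeroth-law shape for any choice of Leray–Hopf solutions: a
dissipation floor `ε` forces `Gⱼ ≤ 2νⱼ/ε`, whence `⟨‖uⱼ‖²⟩ ≥ ε/(16π²νⱼ) → ∞`
(`not_zerothLaw_shape_kolmogorovPlane`). This contains the rest datum
(`SingleModeLaminarUnique.not_zerothLaw_shape_kolmogorov_rest`), the laminar line and the drift
states (`DriftModeUnique.not_zerothLaw_shape_kolmogorovDrift`) as special cases.
-/

noncomputable section
-- the mandated namespace `Summit.<Summit>.<Problem>.Theorems` repeats `AnomalousDissipation` (single-problem summit)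
set_option linter.dupNamespace false

namespace Summit.AnomalousDissipation.AnomalousDissipation.Theorems.DriftStatesAreLerayHopf.Negative

open MeasureTheory Set Filter Topology UnitAddTorus
open scoped ENNReal NNReal InnerProductSpace ContDiff
open Literature.Analysis.FunctionSpaces Literature.Analysis.FunctionSpaces.Torus
open Literature.Analysis.FluidPDE Literature.Analysis.FluidPDE.Torus

variable {k : Fin 3 → ℤ} {v : EuclideanSpace ℝ (Fin 3)}

/-- The spectral `‖∇·‖₂²` only sees the a.e.-class. [folklore] -/
private theorem eGradNormSq_congr_ae₄ {f g : UnitAddTorus (Fin 3) → EuclideanSpace ℝ (Fin 3)}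
    (h : f =ᵐ[volume] g) : eGradNormSq f = eGradNormSq g := by
  have h' : (EuclideanSpace.complexify ∘ f) =ᵐ[volume] (EuclideanSpace.complexify ∘ g) :=
    h.fun_comp EuclideanSpace.complexify
  unfold eGradNormSq eHomSobolevSeminorm
  simp_rw [mFourierCoeff_congr_ae h']

/-! ## 1. Means of every Leray–Hopf solution from plane data -/

/-- **Means from the drift plane.** For `ν > 0`, `k ≠ 0`, `⟪k,v⟫ = 0`, drift `W`, steady amplitudes
`(a⋆, b⋆)` and ANY initial amplitudes `(a₀, b₀)`: every global Leray–Hopf solution with the steady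
single-mode force `(νλa⋆ − ωb⋆) sin v + (νλb⋆ + ωa⋆) cos v` from the datum `W + a₀ sin v + b₀ cos v`
has `⟨‖u‖²⟩ = ‖W‖² + ½‖v‖²(a⋆² + b⋆²)` and `⟨ν‖∇u‖²⟩ = νλ·½‖v‖²(a⋆² + b⋆²)`. [folklore] -/
theorem means_eq_of_isGlobalLerayHopf_driftPlane (hk : k ≠ 0) (hkv : ⟪latticeVec k, v⟫_ℝ = 0)
    (W : EuclideanSpace ℝ (Fin 3)) (aS bS a₀ b₀ : ℝ) {ν : ℝ} (hν : 0 < ν)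
    {u : ℝ → UnitAddTorus (Fin 3) → EuclideanSpace ℝ (Fin 3)}
    (hu : IsGlobalLerayHopf ν
      (fun _ (x : UnitAddTorus (Fin 3)) =>
        (ν * stokesEigenvalue k * aS - 2 * Real.pi * ⟪latticeVec k, W⟫_ℝ * bS) • stokesMode k v false x +
          (ν * stokesEigenvalue k * bS + 2 * Real.pi * ⟪latticeVec k, W⟫_ℝ * aS) • stokesMode k v true x)
      (fun x : UnitAddTorus (Fin 3) => W + a₀ • stokesMode k v false x + b₀ • stokesMode k v true x) u) :
    meanEnergy u = ‖W‖ ^ 2 + ‖v‖ ^ 2 / 2 * (aS ^ 2 + bS ^ 2) ∧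
      meanDissipation ν u = ν * (stokesEigenvalue k * (‖v‖ ^ 2 / 2 * (aS ^ 2 + bS ^ 2))) := by
  have hμ : 0 < ν * stokesEigenvalue k := mul_pos hν (stokesEigenvalue_pos hk)
  obtain ⟨a, b, ha, hb, ha0, hb0, hda, hdb, hta, htb⟩ :=
    exists_driftPlane_amplitudes hμ (2 * Real.pi * ⟪latticeVec k, W⟫_ℝ) aS bS a₀ b₀
  have hda' : ∀ t, HasDerivAt a (-(ν * stokesEigenvalue k) * (a t - aS) +
      2 * Real.pi * ⟪latticeVec k, W⟫_ℝ * (b t - bS)) t := fun t => by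
    simpa [neg_mul] using hda t
  have hdb' : ∀ t, HasDerivAt b (-(ν * stokesEigenvalue k) * (b t - bS) -
      2 * Real.pi * ⟪latticeVec k, W⟫_ℝ * (a t - aS)) t := fun t => by
    simpa [neg_mul] using hdb t
  have hcl := isClassicalNSSolutionOn_driftPlane hkv W aS bS ν ha hb hda' hdb'
  have hdat : (fun x : UnitAddTorus (Fin 3) => W + a₀ • stokesMode k v false x + b₀ • stokesMode k v true x) =
      (fun t (x : UnitAddTorus (Fin 3)) => W + a t • stokesMode k v false x + b t • stokesMode k v true x) 0 := by
    funext x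
    simp only [ha0, hb0]
  rw [hdat] at hu
  have hae := hu.ae_eq_of_isClassicalNSSolutionOn_univ_forced hcl hν.le
  refine ⟨?_, ?_⟩
  · rw [← meanEnergy_driftPlane hk v W ha.continuous hb.continuous hta htb, meanEnergy_eq_longTimeAvgSup,
      meanEnergy_eq_longTimeAvgSup]
    refine longTimeAvgSup_congr_of_eqOn_Ioi fun t ht => integral_congr_ae ?_
    filter_upwards [hae t ht] with x hx
    rw [hx]
  · rw [← meanDissipation_driftPlane hk v W ν ha.continuous hb.continuous hta htb]
    unfold meanDissipation
    refine longTimeAvgSup_congr_of_eqOn_Ioi fun t ht => ?_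
    rw [eGradNormSq_congr_ae₄ (hae t ht)]

/-! ## 2. The Kolmogorov plane -/

/-- `⟪latticeVec (0,2,0), W⟫ = 2 W₁`. [folklore] -/
theorem inner_latticeVec_kolmogorov (W : EuclideanSpace ℝ (Fin 3)) :
    ⟪latticeVec (![0, 2, 0] : Fin 3 → ℤ), W⟫_ℝ = 2 * W 1 := by
  have h : latticeVec (![0, 2, 0] : Fin 3 → ℤ) = (2 : ℝ) • EuclideanSpace.single (1 : Fin 3) (1 : ℝ) := by
    ext i
    rw [latticeVec_apply]
    fin_cases i <;> simp
  rw [h, inner_smul_left, EuclideanSpace.inner_single_left]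
  simp

/-- **Means of EVERY Leray–Hopf solution from the Kolmogorov plane** (force `sin(4πx₁)e₀`, datum
`W + a₀ sin(4πx₁)e₀ + b₀ cos(4πx₁)e₀`, `ν > 0`; `σ = 2W₁`, `G = 64π²ν² + σ²`):
`⟨‖u‖²⟩ = ‖W‖² + 1/(8π²G)` and `⟨ν‖∇u‖²⟩ = 2ν/G` — independent of `(a₀, b₀)`. [folklore] -/
theorem means_eq_of_isGlobalLerayHopf_kolmogorovPlane (W : EuclideanSpace ℝ (Fin 3)) (a₀ b₀ : ℝ) {ν : ℝ}
    (hν : 0 < ν) {u : ℝ → UnitAddTorus (Fin 3) → EuclideanSpace ℝ (Fin 3)}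
    (hu : IsGlobalLerayHopf ν
      (fun _ => ⇑(stokesMode (![0, 2, 0] : Fin 3 → ℤ) (EuclideanSpace.single (0 : Fin 3) (1 : ℝ)) false))
      (fun x : UnitAddTorus (Fin 3) => W +
        a₀ • (stokesMode (![0, 2, 0] : Fin 3 → ℤ) (EuclideanSpace.single (0 : Fin 3) (1 : ℝ)) false x) +
        b₀ • (stokesMode (![0, 2, 0] : Fin 3 → ℤ) (EuclideanSpace.single (0 : Fin 3) (1 : ℝ)) true x)) u) :
    meanEnergy u = ‖W‖ ^ 2 + 1 / (8 * Real.pi ^ 2 * (64 * Real.pi ^ 2 * ν ^ 2 + (2 * W 1) ^ 2)) ∧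
      meanDissipation ν u = 2 * ν / (64 * Real.pi ^ 2 * ν ^ 2 + (2 * W 1) ^ 2) := by
  have hk : (![0, 2, 0] : Fin 3 → ℤ) ≠ 0 := fun h => by simpa using congrFun h 1
  have hkv : ⟪latticeVec (![0, 2, 0] : Fin 3 → ℤ), EuclideanSpace.single (0 : Fin 3) (1 : ℝ)⟫_ℝ = 0 := by
    rw [EuclideanSpace.inner_single_right, latticeVec_apply]
    simp
  have hπ : Real.pi ≠ 0 := Real.pi_ne_zero
  -- `μ = 16π²ν`, `ω = 2πσ`, `σ = 2W₁`; `M = μ² + ω² = 4π²G`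
  set σ : ℝ := 2 * W 1 with hσ
  have hG : 0 < 64 * Real.pi ^ 2 * ν ^ 2 + σ ^ 2 := by positivity
  set M : ℝ := (ν * (16 * Real.pi ^ 2)) ^ 2 + (2 * Real.pi * σ) ^ 2 with hM
  have hM4 : M = 4 * Real.pi ^ 2 * (64 * Real.pi ^ 2 * ν ^ 2 + σ ^ 2) := by rw [hM]; ring
  have hM0 : M ≠ 0 := by rw [hM4]; positivity
  -- steady amplitudes
  set aS : ℝ := ν * (16 * Real.pi ^ 2) / M with haS
  set bS : ℝ := -(2 * Real.pi * σ) / M with hbS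
  have hs : ν * (16 * Real.pi ^ 2) * aS - 2 * Real.pi * σ * bS = 1 := by
    rw [haS, hbS]
    field_simp
    ring
  have hc : ν * (16 * Real.pi ^ 2) * bS + 2 * Real.pi * σ * aS = 0 := by
    rw [haS, hbS]
    field_simp
    ring
  have hsq : aS ^ 2 + bS ^ 2 = 1 / M := by
    rw [haS, hbS]
    field_simp
    ring
  have h := means_eq_of_isGlobalLerayHopf_driftPlane (u := u) hk hkv W aS bS a₀ b₀ hν
  rw [stokesEigenvalue_kolmogorov, inner_latticeVec_kolmogorov, ← hσ, hs, hc] at h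
  simp only [one_smul, zero_smul, add_zero] at h
  obtain ⟨hE, hD⟩ := h hu
  refine ⟨?_, ?_⟩
  · rw [hE, hsq, hM4]
    simp
    field_simp
    ring
  · rw [hD, hsq, hM4]
    simp
    field_simp
    ring

/-- **The Kolmogorov plane carries no zeroth-law witness.** For viscosities `νⱼ > 0`, `νⱼ → 0`,
ANY data on the invariant plane of the forced mode (drifts `Wⱼ ∈ ℝ³`, amplitudes `a₀ⱼ, b₀ⱼ`, all
depending on `j` arbitrarily) and ANY global Leray–Hopf solutions `uⱼ` from them, bounded mean
energy and a positive dissipation floor cannot hold together: a floor `ε ≤ 2νⱼ/Gⱼ` gives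
`Gⱼ ≤ 2νⱼ/ε` and then `⟨‖uⱼ‖²⟩ ≥ 1/(8π²Gⱼ) ≥ ε/(16π²νⱼ) → ∞`. [folklore] -/
theorem not_zerothLaw_shape_kolmogorovPlane {ν : ℕ → ℝ} (hν : ∀ j, 0 < ν j)
    (hν0 : Tendsto ν atTop (𝓝 0)) (W : ℕ → EuclideanSpace ℝ (Fin 3)) (a₀ b₀ : ℕ → ℝ)
    {u : ℕ → ℝ → UnitAddTorus (Fin 3) → EuclideanSpace ℝ (Fin 3)}
    (hu : ∀ j, IsGlobalLerayHopf (ν j)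
      (fun _ => ⇑(stokesMode (![0, 2, 0] : Fin 3 → ℤ) (EuclideanSpace.single (0 : Fin 3) (1 : ℝ)) false))
      (fun x : UnitAddTorus (Fin 3) => W j +
        a₀ j • (stokesMode (![0, 2, 0] : Fin 3 → ℤ) (EuclideanSpace.single (0 : Fin 3) (1 : ℝ)) false x) +
        b₀ j • (stokesMode (![0, 2, 0] : Fin 3 → ℤ) (EuclideanSpace.single (0 : Fin 3) (1 : ℝ)) true x)) (u j)) :
    ¬ ((∃ E : ℝ, ∀ j, meanEnergy (u j) ≤ E) ∧ ∃ ε : ℝ, 0 < ε ∧ ∀ j, ε ≤ meanDissipation (ν j) (u j)) := by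
  rintro ⟨⟨E, hE⟩, ε, hε, hfl⟩
  have hπ : 0 < Real.pi := Real.pi_pos
  -- pick `j` with `ν j < ε / (16π²(|E| + 1))`
  have hsmall : ∀ᶠ j in atTop, ν j < ε / (16 * Real.pi ^ 2 * (|E| + 1)) :=
    (tendsto_order.1 hν0).2 _ (by positivity)
  obtain ⟨j, hj⟩ := hsmall.exists
  obtain ⟨hEj, hDj⟩ := means_eq_of_isGlobalLerayHopf_kolmogorovPlane (W j) (a₀ j) (b₀ j) (hν j) (hu j)
  have hνj := hν j
  set G : ℝ := 64 * Real.pi ^ 2 * ν j ^ 2 + (2 * W j 1) ^ 2 with hG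
  have hG0 : 0 < G := by rw [hG]; positivity
  -- floor ⇒ `G ε ≤ 2ν`
  have h1 : ε ≤ 2 * ν j / G := hDj ▸ hfl j
  have hGle : G * ε ≤ 2 * ν j := by
    rw [le_div_iff₀ hG0] at h1
    linarith
  -- energy ⇒ `1/(8π²G) ≤ |E|`
  have h2 : ‖W j‖ ^ 2 + 1 / (8 * Real.pi ^ 2 * G) ≤ E := hEj ▸ hE j
  have h3 : 1 / (8 * Real.pi ^ 2 * G) ≤ |E| := by
    have := le_abs_self E
    nlinarith [norm_nonneg (W j), sq_nonneg ‖W j‖]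
  have h5 : 1 ≤ |E| * (8 * Real.pi ^ 2 * G) := by
    rwa [div_le_iff₀ (by positivity)] at h3
  -- combine: `ε ≤ 8π²|E|·Gε ≤ 16π²|E| ν ≤ 16π²(|E|+1) ν`
  have h6 : ε * 1 ≤ ε * (|E| * (8 * Real.pi ^ 2 * G)) := mul_le_mul_of_nonneg_left h5 hε.le
  have h7 : 8 * Real.pi ^ 2 * |E| * (G * ε) ≤ 8 * Real.pi ^ 2 * |E| * (2 * ν j) :=
    mul_le_mul_of_nonneg_left hGle (by positivity)
  have h8 : 0 ≤ Real.pi ^ 2 * ν j := by positivity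
  have h4 : ε / (16 * Real.pi ^ 2 * (|E| + 1)) ≤ ν j := by
    rw [div_le_iff₀ (by positivity)]
    nlinarith [h6, h7, h8]
  exact absurd hj (not_lt.2 h4)

end Summit.AnomalousDissipation.AnomalousDissipation.Theorems.DriftStatesAreLerayHopf.Negative

end
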